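import Summits.QuantumFields.QCD.Theorems.TiltedFlatness.Negative.TwoWellFloor

/-!
# Conditional refutation of `PauliWegnerSea.TiltedFlatness` AS TYPED AT rev 3 (item stmt-QuantumFields-11511, crux K3)

`theorem PauliWegnerSeaTiltedFlatnessRev3_refuted : TiltedFlatnessTwinWell → ¬ TiltedFlatnessRev3`
(deprecated alias `PauliWegnerSeaTiltedFlatness_refuted`).

REPAIR 2026-08-16: route rev 4 (2026-08-16T00:14Z) RESTATED the crux under the SAME decl name
`Theses.PauliWegnerSea.TiltedFlatness` as the repaired statement `C′` = stmt-QuantumFields-14070 (clause (b′)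
`ν(F ≤ εM) ≤ C (1+β)^p ε^c`; since PROVED, `Theorems.CircleTransport.TiltedFlatness_proof`), which the twin-well
witness misses; item stmt-11511 was retired. The landed negative lemma (p71372), textually unchanged, would now
assert `¬ C′` and stopped elaborating at its last step (`hb : … ≤ C (1+β)^p ε^c` against `… ≤ C ε^c`, full
builds of 2026-08-16). The rev-3 statement it refutes is therefore recorded below as `TiltedFlatnessRev3`
(ledger signature of stmt-11511 verbatim), the lemma is re-homed on it with its proof unchanged, and the old
name survives as a deprecated alias (Theorems files are append-only).

Clause (b) of the crux asks for `C, c > 0` (depending on `N_f` only) with `ν_β(F ≤ ε M_β) ≤ C ε^c`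
for every `ε > 0`, UNIFORMLY in the tilt `β ≥ 0` and in the outside configuration, where
`ν_β ∝ exp(-β · wilsonAction ∘ refit) · Haar^{⊗ edges}` is the star-conditional Wilson law,
`F = ‖det diracMatrix ∘ refit‖` and `M_β` its tilted mean.  This file proves in full the soft half of
the counter-argument — `laplace_concentration` (tilted weights of a continuous phase on a compact
space concentrate on any open set containing its global minimisers), `small_ball_floor` (two wells
exchanged by a measure-preserving continuous involution fixing the phase, amplitude `F ≥ 0` zero on
one well and positive on the other ⟹ for every `ε > 0` some tilt has `M_β > 0` and
`ν_β(F ≤ ε M_β) ≥ 1/4`), the continuity of `wilsonAction`, of the `wilsonDirac` entries and of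
`diracMatrix` in the configuration, and the instantiation (`ε = (8C)^{-1/c}` gives `1/4 ≤ 1/8`).
The other half is the HYPOTHESIS `TiltedFlatnessTwinWell`: one admissible outside whose fibre action
has two symmetric wells with `F ≡ 0` on one and `F > 0` on the other — a static finite-dimensional
statement, certified off-line in cycle 1 of the crux disprover (exact `ℤ[ζ₁₆]` argmax certificate
for a circulant colour-diagonal staple design on `SU(3)^8`, Haar symmetry `V ↦ conj(V)·D`, certified
sign change of the real Wilson–Dirac determinant on the `4⁴` torus at `m* ≈ -0.68809` on one well
against a spectral gap on the other; evidence `REFUTATION.md`, `Disproof.lean`,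
`tf11511_evidence_bundle.txt` on the item) but not provable in Lean today (verified numerics on a
`3072 × 3072` determinant).  Hence the refutation is CONDITIONAL (`--conditional-on`), holding the item.

Classification: refuted-misstated (conditional).  The witness uses only the `β`-uniformity of
`(C, c)`; the repaired statement `C′` is the route's own kill-criteria pivot — clause (a) verbatim
and (b′) `ν(F ≤ εM) ≤ C (1+β)^p ε^c` — which the witness misses (it obeys `≤ C(1+β)^{1/2} ε`); the
consumer `FMClosureUnquenched` takes `TiltedFlatness` verbatim as antecedent and regenerates with `C′`.
-/

namespace Summit.QuantumFields.QCD.Theorems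

open MeasureTheory Filter Set
open Literature.MathematicalPhysics.QuantumFieldTheory Literature.MathematicalPhysics.QuantumLattice
  Literature.Probability.LatticeModels
open TiltedFlatnessNegative

/-- **Twin-well outside** — the computational kernel of the refutation of `TiltedFlatness` (b).
Some admissible instance of the crux data (flavour number `Nf`, masses `mq ∈ [-2,2]^Nf`, a torus
of side `L ≥ 4`, an outside configuration `U`, sites `x, y`) has, for the crux's star-refit
`refit`, fibre action `S(W) = wilsonAction(refit W)` and fermionic weight
`F(W) = ‖det diracMatrix (refit W) mq‖`, TWO WELLS EXCHANGED BY A SYMMETRY: a closed non-empty set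
`O₁` and a set `O₂` of configurations and a continuous involution `Φ` preserving the product Haar
measure and `S`, mapping `O₁` into `O₂` and `O₂` into `O₁`, such that every global minimiser of
`S` lies in `O₁ ∪ O₂`, `F ≡ 0` on `O₁` and `F > 0` on `O₂`.  Witness (cycle 1 of the crux
disprover, certified off-line): `x = y`, `L = 4`, `Nf = 1`, circulant colour-diagonal staples
`diag(ζ⁻¹,ζ⁻²,ζ³)`, `diag(ζ⁻²,ζ⁴,ζ⁻²)`, `diag(ζ⁻³,ζ²,ζ)`, `ζ = e^{iπ/8}`, whose star action has
argmax exactly two gauge orbits swapped by `Φ : V_ℓ ↦ conj(V_ℓ)·D_ℓ`; abelian `Q = 1` far field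
and `m* ≈ -0.68809` with `det D_W ≡ 0` on `O₁` and `≠ 0` on `O₂`.  (Hypothesis of a
CONDITIONAL refutation, `--conditional-on`; not a literature fact — deliberately untagged.) -/
def TiltedFlatnessTwinWell : Prop :=
  ∃ (Nf : ℕ) (mq : Fin Nf → ℝ) (_ : ∀ f, -2 ≤ mq f ∧ mq f ≤ 2) (L : ℕ) (_ : NeZero L)
    (_ : 4 ≤ L) (U : GaugeConfig 4 L (Matrix.specialUnitaryGroup (Fin 3) ℂ))
    (x y : TorusSite 4 L)
    (O₁ O₂ : Set (GaugeConfig 4 L (Matrix.specialUnitaryGroup (Fin 3) ℂ)))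
    (Φ : GaugeConfig 4 L (Matrix.specialUnitaryGroup (Fin 3) ℂ) →
      GaugeConfig 4 L (Matrix.specialUnitaryGroup (Fin 3) ℂ)),
    let star : Edge 4 L → Prop :=
      fun e => e.1 = x ∨ Site.shift e.1 e.2 = x ∨ e.1 = y ∨ Site.shift e.1 e.2 = y
    let refit : GaugeConfig 4 L (Matrix.specialUnitaryGroup (Fin 3) ℂ) →
        GaugeConfig 4 L (Matrix.specialUnitaryGroup (Fin 3) ℂ) :=
      fun W e => if star e then W e else U e
    let F : GaugeConfig 4 L (Matrix.specialUnitaryGroup (Fin 3) ℂ) → ℝ :=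
      fun W => ‖(diracMatrix (refit W) mq).det‖
    let S : GaugeConfig 4 L (Matrix.specialUnitaryGroup (Fin 3) ℂ) → ℝ :=
      fun W => wilsonAction (fundamentalRep (Fin 3)) (refit W)
    let haar : Measure (GaugeConfig 4 L (Matrix.specialUnitaryGroup (Fin 3) ℂ)) :=
      Measure.pi fun _ => haarProbability (Matrix.specialUnitaryGroup (Fin 3) ℂ)
    IsClosed O₁ ∧ O₁.Nonempty ∧ Continuous Φ ∧ (∀ W, Φ (Φ W) = W) ∧
      MeasurePreserving Φ haar haar ∧ (∀ W, S (Φ W) = S W) ∧ MapsTo Φ O₁ O₂ ∧ MapsTo Φ O₂ O₁ ∧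
      (∀ W, (∀ W', S W ≤ S W') → W ∈ O₁ ∪ O₂) ∧ (∀ W ∈ O₁, F W = 0) ∧ (∀ W ∈ O₂, 0 < F W)

/-- **Record of the replaced route item `TiltedFlatness`, rev 3** = stmt-QuantumFields-11511 (ledger signature
verbatim; NOT a route item): clause (a) `F(W₀) ≤ C (1+β)^p M_β` and clause (b) `ν_β(F ≤ ε M_β) ≤ C ε^c` with `C, c`
UNIFORM in the tilt `β ≥ 0` and in the outside configuration. Route rev 4 (2026-08-16T00:14Z) restated the crux
under the same decl name `Theses.PauliWegnerSea.TiltedFlatness` as `C′` = stmt-QuantumFields-14070 ((b′) with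
`C (1+β)^p ε^c`; proved, `Theorems.CircleTransport.TiltedFlatness_proof`) and retired stmt-11511, so the original
name is taken; the rev-3 statement is re-declared here under a Theorems-local name solely so that the landed
conditional refutation below keeps elaborating. FALSE given `TiltedFlatnessTwinWell` (refuted below). -/
def TiltedFlatnessRev3 : Prop :=
  open MeasureTheory Filter Literature.MathematicalPhysics.QuantumFieldTheory Literature.MathematicalPhysics.QuantumLattice Literature.Probability.LatticeModels in ∀ Nf : ℕ, ∃ C p c : ℝ, 0 < C ∧ 0 < c ∧ ∀ β : ℝ, 0 ≤ β → ∀ mq : Fin Nf → ℝ, (∀ f, -2 ≤ mq f ∧ mq f ≤ 2) → ∀ (L : ℕ) [NeZero L], 4 ≤ L → ∀ (U : GaugeConfig 4 L (Matrix.specialUnitaryGroup (Fin 3) ℂ)) (x y : TorusSite 4 L), let star : Edge 4 L → Prop := fun e => e.1 = x ∨ Site.shift e.1 e.2 = x ∨ e.1 = y ∨ Site.shift e.1 e.2 = y; let refit : GaugeConfig 4 L (Matrix.specialUnitaryGroup (Fin 3) ℂ) → GaugeConfig 4 L (Matrix.specialUnitaryGroup (Fin 3) ℂ) := fun W e =>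 if star e then W e else U e; let F : GaugeConfig 4 L (Matrix.specialUnitaryGroup (Fin 3) ℂ) → ℝ := fun W => ‖(diracMatrix (refit W) mq).det‖; let wt : GaugeConfig 4 L (Matrix.specialUnitaryGroup (Fin 3) ℂ) → ℝ := fun W => Real.exp (-(β * wilsonAction (fundamentalRep (Fin 3)) (refit W))); let haar : Measure (GaugeConfig 4 L (Matrix.specialUnitaryGroup (Fin 3) ℂ)) := Measure.pi fun _ => haarProbability (Matrix.specialUnitaryGroup (Fin 3) ℂ); let Z : ℝ := ∫ W, wt W ∂haar; let M : ℝ := (∫ W, F W * wt W ∂haar) / Z; (∀ W₀ : GaugeConfig 4 L (Matrix.specialUnitaryGroup (Fin 3) ℂ), F W₀ ≤ C * (1 + β) ^ p * M) ∧ (0 < M → ∀ ε : ℝ, 0 < ε → (∫ W, (if F W ≤ ε * M then (1 : ℝ) else 0) * wt W ∂haar) / Z ≤ C * ε ^ c)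

/-- Refutes `PauliWegnerSea.TiltedFlatness` AS TYPED AT rev 3 (`TiltedFlatnessRev3` = stmt-QuantumFields-11511)
CONDITIONALLY on `TiltedFlatnessTwinWell`
[refuted-misstated, conditional]: clause (b) of the crux (relative small balls
`ν_β(F ≤ εM) ≤ Cε^c` with `C, c` uniform in `β` AND in the outside) fails as soon as one outside
has two symmetric wells with `F ≡ 0` on one and `F > 0` on the other: by `laplace_concentration`
and the symmetry each well keeps tilted mass `→ 1/2`, the tilted mean stays `≥ θ/4 > 0` through
the good well while `F < ε M_β` near the bad one, so `ν_β(F ≤ εM_β) ≥ 1/4 > Cε^c` at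
`ε = (8C)^{-1/c}`, `β` large (`small_ball_floor`).  Witness for the hypothesis: the cycle-1
two-well outside (docstring of `TiltedFlatnessTwinWell`; item evidence REFUTATION.md /
Disproof.lean / tf11511_evidence_bundle.txt).  Repaired statement `C′` (believed true; the route's
kill-criteria pivot): (b) with `C (1+β)^p ε^c`, (a) unchanged; the witness misses `C′`.
[folklore] -/
theorem PauliWegnerSeaTiltedFlatnessRev3_refuted :
    TiltedFlatnessTwinWell → ¬ TiltedFlatnessRev3 := by
  rintro ⟨Nf, mq, hmq, L, hL0, hL4, U, x, y, O₁, O₂, Φ, hO₁, hne, hΦc, hΦi, hΦμ, hΦS, h12, h21,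
    hargmin, hF1, hF2⟩ hTF
  obtain ⟨C, p, c, hC, hc, H⟩ := hTF Nf
  -- the scale `ε` with `C ε^c = 1/8`
  set ε : ℝ := (1 / (8 * C)) ^ c⁻¹ with hε
  have hεpos : 0 < ε := Real.rpow_pos_of_pos (by positivity) _
  have hCε : C * ε ^ c = 1 / 8 := by
    rw [hε, Real.rpow_inv_rpow (by positivity) hc.ne']
    field_simp
  haveI : (Measure.pi fun _ : Edge 4 L =>
      haarProbability (Matrix.specialUnitaryGroup (Fin 3) ℂ)).IsOpenPosMeasure := by
    unfold haarProbability; infer_instance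
  -- continuity of the star refit, then the two-well floor at this instance
  have hrefit : Continuous (fun W : GaugeConfig 4 L (Matrix.specialUnitaryGroup (Fin 3) ℂ) =>
      fun e : Edge 4 L =>
        if (e.1 = x ∨ Site.shift e.1 e.2 = x ∨ e.1 = y ∨ Site.shift e.1 e.2 = y) then W e
        else U e) := by
    refine continuous_pi fun e => ?_
    by_cases h : (e.1 = x ∨ Site.shift e.1 e.2 = x ∨ e.1 = y ∨ Site.shift e.1 e.2 = y)
    · simp only [if_pos h]; exact continuous_apply e
    · simp only [if_neg h]; exact continuous_const
  obtain ⟨β, hβ0, hM, hquarter⟩ := small_ball_floor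
    (Measure.pi fun _ : Edge 4 L => haarProbability (Matrix.specialUnitaryGroup (Fin 3) ℂ))
    ((continuous_wilsonAction (fundamentalRep (Fin 3)) (continuous_fundamentalRep (Fin 3))).comp
      hrefit)
    (continuous_norm.comp ((continuous_diracMatrix mq).comp hrefit).matrix_det)
    (fun W => norm_nonneg _) hO₁ hne hΦc hΦi hΦμ hΦS h12 h21 hargmin hF1 hF2 hεpos
  -- clause (b) of the crux at `β`, the masses `mq`, the outside `U` and the sites `x, y`
  obtain ⟨-, hb⟩ := H β hβ0 mq hmq L hL4 U x y
  have h14 : (1 / 4 : ℝ) ≤ C * ε ^ c := hquarter.trans (hb hM ε hεpos)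
  rw [hCε] at h14
  norm_num at h14

/-- Deprecated spelling of `PauliWegnerSeaTiltedFlatnessRev3_refuted`: the landed negative lemma (p71372) was
`TiltedFlatnessTwinWell → ¬ Theses.PauliWegnerSea.TiltedFlatness` against the rev-3 crux (stmt-QuantumFields-11511);
that decl name has carried the restated crux `C′` (stmt-QuantumFields-14070, proved) since route rev 4, so the lemma
now targets the verbatim record `TiltedFlatnessRev3` of the statement it actually refutes. [folklore] -/
@[deprecated PauliWegnerSeaTiltedFlatnessRev3_refuted (since := "2026-08-16")]
alias PauliWegnerSeaTiltedFlatness_refuted := PauliWegnerSeaTiltedFlatnessRev3_refuted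

end Summit.QuantumFields.QCD.Theorems
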